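import Summits.BirchSwinnertonDyer.BirchSwinnertonDyer.Theorems.ResidualThetaTransportAtTwoSignedMuSeedAtTwoPlusJetRhoLogDeriv
import Summits.BirchSwinnertonDyer.BirchSwinnertonDyer.Theorems.ResidualThetaTransportAtTwoSignedMuSeedAtTwoPlusJetTranslation
import HarnessLib

/-!
# The reduced Robert factor is a RICCATI solution: `D x = 1` on `y² + y = x³` in characteristic `2`
# (seed lines `norm-field-tilt` / `jet-character-sums`; crux `SignedMuSeedAtTwoPlus` stmt-BirchSwinnertonDyer-21438; Kμ⁺ stmt-BirchSwinnertonDyer-20689)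

Cell `bsd-wall`, width seat `bsd-wall-rtt-p4-w2` g14 (`--supports`, closes nothing).  THEOREMS ONLY (no `def`, no named fact, no instance,
no `sorry`); nothing about any elliptic unit, class or `μ`-invariant is asserted; the lines are NOT registered (W-79); BSD is not proved by this.

The tilt dictionary (card `Lines/norm-field-tilt.md` S1 (ii), engine `stage4.py`) expands the REDUCED ROBERT FUNCTION on the supersingular curve
`Ẽ : y² + y = x³` as `θ̄ = ∏_P (x(t ⊕ Q̃) − x(P))⁻¹`; for `𝔣₀ = 1` (calibration class, the S4-probe functions) the factors are
`θ_c := 1/(x(t) + c) = w/(t + c·w)` (`x = t/w`, AEC IV.1), for `𝔣₀ ≠ 1` they are `φ_P = 1/(d + q)` with `q = x(Q′ ⊕ T(t)) − x′`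
(`…JetTranslation.translationJet`: `q·(t + x′w)² = w(1 + x′²t + y′²w)`).  The jet card (`Lines/jet-character-sums.md`, J3) then READS the
log-derivative `Φ = D log θ̄` (`D = η·d/dt = d/dt`, `η = 1` by `Tilt.formalEta_eq_one`) as the SUM of the factors.  That identification is the
content of this file — it is «`D x = 1`» (`ω = dx/(2y + a₁x + a₃) = dx` in characteristic `2` with `a₁ = 0`, `a₃ = 1`):

* §1 `derivative_formalW_tiltCurve` (`w' = t²`), `X_mul_derivative_formalW_add_formalW` (`t·w' + w = w²`) — i.e. `(t/w)' = (w − t·w')/w² = 1`.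
* §2 the `𝔣₀ = 1` factor, characterised by `θ·(t + c·w) = w`: `exists_robertFactor`, `robertFactor_unique` (`t + c·w = t·unit`,
  `mul_robertDen_cancel`), `X_sq_dvd_robertFactor`, `constantCoeff_robertFactor`, and **`derivative_robertFactor`: `θ' = θ²`**.
* §3 the `𝔣₀ ≠ 1` factor: **`derivative_translationQuotient`: `q' = 1`** for every `q` with `q·(t + x′w)² = w(1 + x′²t + y′²w)` (all `x′ y′`, the
  curve equation is not used), hence **`derivative_eq_sq_of_mul_eq_one`: `φ·(d + q) = 1 ⟹ φ' = φ²`** (the `φ` of `…JetInverse.coeff_inv_jet`).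
* §4 Riccati closure in characteristic `2`: `riccati_add`, `riccati_sum`, `riccati_C_mul_rescale`, **`riccati_rhoSymm`** (`S₀ = λΦ(λt) + λ²Φ(λ²t)`
  is Riccati when `Φ` is — hypothesis `hR : S' = S²` of `…JetLevelOneWall`), and the `D log` packaging **`prod_mul_sum_eq_derivative_prod`**:
  `(∏ᵢ φᵢ)·(Σᵢ φᵢ) = (∏ᵢ φᵢ)'` — `Σ_P φ_P` IS `D log ∏_P φ_P`, the input `Z·S = Z'` of `logDeriv_rhoProduct_one` / `Tilt.oddDigit_of_nonDeg_tiltCurve`.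

References: [SilvermanAEC2009] IV.1 (`w = t³ + a₃w² + …`, `x = t/w`, `ω`); the cards quoted above. [folklore]
-/

set_option autoImplicit false
-- the Theorems namespace of this sub repeats the summit name by design (D-0017 nested layout)
set_option linter.dupNamespace false

noncomputable section

open PowerSeries

namespace Summit.BirchSwinnertonDyer.BirchSwinnertonDyer.Theorems.SignedMuAtTwo.JetCharacterSums

variable {R : Type*} [CommRing R]

/-! ## §1 `D x = 1`: `w' = t²` and `t·w' + w = w²` -/

section DxOne

variable (R) [CharP R 2]

/-- **`w' = t²`** for the formal `w` of the tilt curve `y² + y = x³` in characteristic `2`: differentiate `w = t³ + w²`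
(`3t² = t²`, `2ww' = 0`). [cite: SilvermanAEC2009, IV.1.1] -/
theorem derivative_formalW_tiltCurve : d⁄dX R (⟨0, 0, 1, 0, 0⟩ : WeierstrassCurve R).formalW = X ^ 2 := by
  set w := (⟨0, 0, 1, 0, 0⟩ : WeierstrassCurve R).formalW with hw
  have hfix : w = X ^ 3 + w ^ 2 := formalW_eq_X_pow_three_add_sq R
  have h2 := two_eq_zero_powerSeries (R := R)
  have hd : d⁄dX R w = d⁄dX R (X ^ 3 + w ^ 2) := congrArg (d⁄dX R) hfix
  rw [map_add, Derivation.leibniz_pow, Derivation.leibniz_pow, derivative_X] at hd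
  simp only [smul_eq_mul, nsmul_eq_mul, Nat.cast_ofNat, mul_one] at hd
  linear_combination hd + (X ^ 2 + w * d⁄dX R w) * h2

/-- **`t·w' + w = w²`** (characteristic `2`): with `x = t/w` this is `D x = (w − t w')/w² = 1` — the invariant differential of
`y² + y = x³` is `ω = dx`, and `ω = dt` in the parameter `t` (`η = 1`). [cite: SilvermanAEC2009, IV.1.1] -/
theorem X_mul_derivative_formalW_add_formalW :
    X * d⁄dX R (⟨0, 0, 1, 0, 0⟩ : WeierstrassCurve R).formalW + (⟨0, 0, 1, 0, 0⟩ : WeierstrassCurve R).formalW =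
      (⟨0, 0, 1, 0, 0⟩ : WeierstrassCurve R).formalW ^ 2 := by
  have hfix := formalW_eq_X_pow_three_add_sq R
  have h2 := two_eq_zero_powerSeries (R := R)
  rw [derivative_formalW_tiltCurve]
  linear_combination hfix + X ^ 3 * h2

end DxOne

/-! ## §2 The `𝔣₀ = 1` Robert factor `θ_c = w/(t + c·w) = 1/(x + c)` -/

section RobertFactor

/-- The denominator `t + c·w = t·(1 + c t²·B)` with `B = w/t³` (`formalWDivCube`, constant term `1`). [cite: SilvermanAEC2009, IV.1.1] -/
theorem robertDen_eq (c : R) :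
    X + C c * (⟨0, 0, 1, 0, 0⟩ : WeierstrassCurve R).formalW =
      X * (1 + C c * X ^ 2 * (⟨0, 0, 1, 0, 0⟩ : WeierstrassCurve R).formalWDivCube) := by
  rw [(⟨0, 0, 1, 0, 0⟩ : WeierstrassCurve R).formalW_eq_X_pow_mul_formalWDivCube]
  ring

/-- The unit factor `u = 1 + c t² B` of the denominator is invertible: `u · u⁻¹ = 1`. [folklore] -/
theorem robertUnit_mul_invOfUnit (c : R) :
    (1 + C c * X ^ 2 * (⟨0, 0, 1, 0, 0⟩ : WeierstrassCurve R).formalWDivCube) *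
        PowerSeries.invOfUnit (1 + C c * X ^ 2 * (⟨0, 0, 1, 0, 0⟩ : WeierstrassCurve R).formalWDivCube) 1 = 1 :=
  PowerSeries.mul_invOfUnit _ _ (by simp)

/-- **Cancellation by the denominator**: `f·(t + c w) = g·(t + c w) ⟹ f = g` (over ANY commutative ring: `t + c w = t · unit` and `t` is a
non-zero-divisor of `R⟦t⟧`). [folklore] -/
theorem mul_robertDen_cancel {c : R} {f g : R⟦X⟧}
    (h : f * (X + C c * (⟨0, 0, 1, 0, 0⟩ : WeierstrassCurve R).formalW) =
      g * (X + C c * (⟨0, 0, 1, 0, 0⟩ : WeierstrassCurve R).formalW)) : f = g := by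
  set u := 1 + C c * X ^ 2 * (⟨0, 0, 1, 0, 0⟩ : WeierstrassCurve R).formalWDivCube with hu
  have hinv : u * PowerSeries.invOfUnit u 1 = 1 := robertUnit_mul_invOfUnit c
  rw [robertDen_eq] at h
  have h' : X * (f * u) = X * (g * u) := by linear_combination h
  have h1 : f * u = g * u := X_mul_cancel h'
  calc f = f * (u * PowerSeries.invOfUnit u 1) := by rw [hinv, mul_one]
    _ = g * u * PowerSeries.invOfUnit u 1 := by rw [← mul_assoc, h1]
    _ = g := by rw [mul_assoc, hinv, mul_one]

/-- **Existence of the Robert factor**: `θ_c := t²·B·(1 + c t² B)⁻¹` solves `θ·(t + c·w) = w` (`= 1/(x + c)` as a function on the curve).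
[cite: SilvermanAEC2009, IV.1.1] -/
theorem exists_robertFactor (c : R) :
    ∃ θ : R⟦X⟧, θ * (X + C c * (⟨0, 0, 1, 0, 0⟩ : WeierstrassCurve R).formalW) = (⟨0, 0, 1, 0, 0⟩ : WeierstrassCurve R).formalW := by
  set u := 1 + C c * X ^ 2 * (⟨0, 0, 1, 0, 0⟩ : WeierstrassCurve R).formalWDivCube with hu
  have hinv : u * PowerSeries.invOfUnit u 1 = 1 := robertUnit_mul_invOfUnit c
  refine ⟨X ^ 2 * (⟨0, 0, 1, 0, 0⟩ : WeierstrassCurve R).formalWDivCube * PowerSeries.invOfUnit u 1, ?_⟩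
  rw [robertDen_eq]
  calc X ^ 2 * (⟨0, 0, 1, 0, 0⟩ : WeierstrassCurve R).formalWDivCube * PowerSeries.invOfUnit u 1 * (X * u)
        = X ^ 3 * (⟨0, 0, 1, 0, 0⟩ : WeierstrassCurve R).formalWDivCube * (u * PowerSeries.invOfUnit u 1) := by ring
    _ = (⟨0, 0, 1, 0, 0⟩ : WeierstrassCurve R).formalW := by
          rw [hinv, mul_one, (⟨0, 0, 1, 0, 0⟩ : WeierstrassCurve R).formalW_eq_X_pow_mul_formalWDivCube]

/-- **Uniqueness of the Robert factor**: the characterising equation `θ·(t + c·w) = w` has exactly one solution. [folklore] -/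
theorem robertFactor_unique {c : R} {θ θ' : R⟦X⟧}
    (hθ : θ * (X + C c * (⟨0, 0, 1, 0, 0⟩ : WeierstrassCurve R).formalW) = (⟨0, 0, 1, 0, 0⟩ : WeierstrassCurve R).formalW)
    (hθ' : θ' * (X + C c * (⟨0, 0, 1, 0, 0⟩ : WeierstrassCurve R).formalW) = (⟨0, 0, 1, 0, 0⟩ : WeierstrassCurve R).formalW) :
    θ = θ' :=
  mul_robertDen_cancel (hθ.trans hθ'.symm)

/-- The closed form: `θ_c = t² · B · (1 + c t² B)⁻¹`. [cite: SilvermanAEC2009, IV.1.1] -/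
theorem robertFactor_eq {c : R} {θ : R⟦X⟧}
    (hθ : θ * (X + C c * (⟨0, 0, 1, 0, 0⟩ : WeierstrassCurve R).formalW) = (⟨0, 0, 1, 0, 0⟩ : WeierstrassCurve R).formalW) :
    θ = X ^ 2 * (⟨0, 0, 1, 0, 0⟩ : WeierstrassCurve R).formalWDivCube *
      PowerSeries.invOfUnit (1 + C c * X ^ 2 * (⟨0, 0, 1, 0, 0⟩ : WeierstrassCurve R).formalWDivCube) 1 := by
  obtain ⟨θ₀, hθ₀⟩ := exists_robertFactor c
  have hinv := robertUnit_mul_invOfUnit c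
  have h0 : X ^ 2 * (⟨0, 0, 1, 0, 0⟩ : WeierstrassCurve R).formalWDivCube *
      PowerSeries.invOfUnit (1 + C c * X ^ 2 * (⟨0, 0, 1, 0, 0⟩ : WeierstrassCurve R).formalWDivCube) 1 *
        (X + C c * (⟨0, 0, 1, 0, 0⟩ : WeierstrassCurve R).formalW) = (⟨0, 0, 1, 0, 0⟩ : WeierstrassCurve R).formalW := by
    rw [robertDen_eq]
    calc X ^ 2 * (⟨0, 0, 1, 0, 0⟩ : WeierstrassCurve R).formalWDivCube *
          PowerSeries.invOfUnit (1 + C c * X ^ 2 * (⟨0, 0, 1, 0, 0⟩ : WeierstrassCurve R).formalWDivCube) 1 *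
            (X * (1 + C c * X ^ 2 * (⟨0, 0, 1, 0, 0⟩ : WeierstrassCurve R).formalWDivCube))
          = X ^ 3 * (⟨0, 0, 1, 0, 0⟩ : WeierstrassCurve R).formalWDivCube *
              ((1 + C c * X ^ 2 * (⟨0, 0, 1, 0, 0⟩ : WeierstrassCurve R).formalWDivCube) *
                PowerSeries.invOfUnit (1 + C c * X ^ 2 * (⟨0, 0, 1, 0, 0⟩ : WeierstrassCurve R).formalWDivCube) 1) := by ring
      _ = (⟨0, 0, 1, 0, 0⟩ : WeierstrassCurve R).formalW := by
            rw [hinv, mul_one, (⟨0, 0, 1, 0, 0⟩ : WeierstrassCurve R).formalW_eq_X_pow_mul_formalWDivCube]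
  exact robertFactor_unique hθ h0

/-- `t² ∣ θ_c` (the Robert factor has order `≥ 2`; `= 2` over a nontrivial ring since `[t²]θ_c = 1`). [folklore] -/
theorem X_sq_dvd_robertFactor {c : R} {θ : R⟦X⟧}
    (hθ : θ * (X + C c * (⟨0, 0, 1, 0, 0⟩ : WeierstrassCurve R).formalW) = (⟨0, 0, 1, 0, 0⟩ : WeierstrassCurve R).formalW) :
    X ^ 2 ∣ θ :=
  ⟨_, by rw [robertFactor_eq hθ, mul_assoc]⟩

/-- `[t⁰]θ_c = 0`. [folklore] -/
theorem constantCoeff_robertFactor {c : R} {θ : R⟦X⟧}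
    (hθ : θ * (X + C c * (⟨0, 0, 1, 0, 0⟩ : WeierstrassCurve R).formalW) = (⟨0, 0, 1, 0, 0⟩ : WeierstrassCurve R).formalW) :
    constantCoeff θ = 0 := by
  obtain ⟨r, hr⟩ := X_sq_dvd_robertFactor hθ
  rw [hr]
  simp

/-- `[t¹]θ_c = 0`. [folklore] -/
theorem coeff_one_robertFactor {c : R} {θ : R⟦X⟧}
    (hθ : θ * (X + C c * (⟨0, 0, 1, 0, 0⟩ : WeierstrassCurve R).formalW) = (⟨0, 0, 1, 0, 0⟩ : WeierstrassCurve R).formalW) :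
    coeff 1 θ = 0 := by
  obtain ⟨r, hr⟩ := X_sq_dvd_robertFactor hθ
  rw [hr, coeff_X_pow_mul']
  simp

/-- `[t²]θ_c = 1` (`θ_c = t²·B·u⁻¹` with `B(0) = u(0) = 1`). [folklore] -/
theorem coeff_two_robertFactor {c : R} {θ : R⟦X⟧}
    (hθ : θ * (X + C c * (⟨0, 0, 1, 0, 0⟩ : WeierstrassCurve R).formalW) = (⟨0, 0, 1, 0, 0⟩ : WeierstrassCurve R).formalW) :
    coeff 2 θ = 1 := by
  have hc : constantCoeff (PowerSeries.invOfUnit (1 + C c * X ^ 2 * (⟨0, 0, 1, 0, 0⟩ : WeierstrassCurve R).formalWDivCube) 1) = 1 := by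
    rw [PowerSeries.constantCoeff_invOfUnit, inv_one, Units.val_one]
  rw [robertFactor_eq hθ, mul_assoc, coeff_X_pow_mul', if_pos le_rfl, Nat.sub_self, coeff_zero_eq_constantCoeff_apply, map_mul,
    hc, mul_one]
  simp

variable [CharP R 2]

/-- **The Robert factor is a Riccati solution: `θ_c' = θ_c²`** (characteristic `2`).  Differentiate `θ·(t + c w) = w`:
`θ'·(t + c w) = t² + θ(1 + c t²)`; multiply by `t + c w` and use `t·w' + w = w²`, `w' = t²`: `θ'·(t + c w)² = w² = θ²(t + c w)²`; cancel.
Equivalently `D(1/(x + c)) = D x/(x + c)² = (1/(x + c))²`. [cite: SilvermanAEC2009, IV.1.1] -/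
theorem derivative_robertFactor {c : R} {θ : R⟦X⟧}
    (hθ : θ * (X + C c * (⟨0, 0, 1, 0, 0⟩ : WeierstrassCurve R).formalW) = (⟨0, 0, 1, 0, 0⟩ : WeierstrassCurve R).formalW) :
    d⁄dX R θ = θ ^ 2 := by
  set w := (⟨0, 0, 1, 0, 0⟩ : WeierstrassCurve R).formalW with hw
  have hfix : w = X ^ 3 + w ^ 2 := formalW_eq_X_pow_three_add_sq R
  have hw' : d⁄dX R w = X ^ 2 := derivative_formalW_tiltCurve R
  have h2 := two_eq_zero_powerSeries (R := R)
  have hd : d⁄dX R (θ * (X + C c * w)) = d⁄dX R w := congrArg (d⁄dX R) hθ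
  rw [Derivation.leibniz, map_add, Derivation.leibniz, derivative_X, derivative_C, hw'] at hd
  simp only [smul_eq_mul, mul_zero, add_zero] at hd
  -- `hd : θ * (1 + C c * X ^ 2) + (X + C c * w) * θ' = X ^ 2`
  have key : d⁄dX R θ * (X + C c * w) * (X + C c * w) = θ ^ 2 * (X + C c * w) * (X + C c * w) := by
    linear_combination (X + C c * w) * hd - ((1 + C c * X ^ 2) + θ * (X + C c * w) + w) * hθ - hfix - w ^ 2 * h2
  exact mul_robertDen_cancel (mul_robertDen_cancel key)

/-- `D log θ_c = θ_c`, packaged as `Z·S = Z'` with `Z = S = θ_c` (the shape consumed by `Tilt.logDeriv_mul`, `logDeriv_rhoProduct_one`). [folklore] -/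
theorem robertFactor_mul_self_eq_derivative {c : R} {θ : R⟦X⟧}
    (hθ : θ * (X + C c * (⟨0, 0, 1, 0, 0⟩ : WeierstrassCurve R).formalW) = (⟨0, 0, 1, 0, 0⟩ : WeierstrassCurve R).formalW) :
    θ * θ = d⁄dX R θ := by
  rw [derivative_robertFactor hθ, sq]

end RobertFactor

/-! ## §3 The `𝔣₀ ≠ 1` factor: `q' = 1` for `q = x(Q′ ⊕ T) − x′`, hence `φ_P' = φ_P²` -/

section TranslationQuotient

variable [CharP R 2]

/-- **`q' = 1`**: every `q` with `q·(t + x′w)² = w·(1 + x′²t + y′²w)` (the quotient of `…JetTranslation.translationJet` /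
`exists_quotient_jet`, i.e. `q = x(Q′ ⊕ T(t)) − x′`) has derivative `1` — `D x = 1` transported by the translation `· ⊕ Q′`
(any `x′ y′ ∈ R`; the curve equation for `Q′` is not used): `(w(1 + x′²t + y′²w))' = t² + x′²(w + t w') = t² + x′²w² = (t + x′w)²`. [cite: SilvermanAEC2009, IV.1.1] -/
theorem derivative_translationQuotient (x y : R) {q : R⟦X⟧}
    (hq : q * (X + C x * (⟨0, 0, 1, 0, 0⟩ : WeierstrassCurve R).formalW) ^ 2 =
      (⟨0, 0, 1, 0, 0⟩ : WeierstrassCurve R).formalW *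
        (1 + C (x ^ 2) * X + C (y ^ 2) * (⟨0, 0, 1, 0, 0⟩ : WeierstrassCurve R).formalW)) :
    d⁄dX R q = 1 := by
  set w := (⟨0, 0, 1, 0, 0⟩ : WeierstrassCurve R).formalW with hw
  have hfix : w = X ^ 3 + w ^ 2 := formalW_eq_X_pow_three_add_sq R
  have hw' : d⁄dX R w = X ^ 2 := derivative_formalW_tiltCurve R
  have h2 := two_eq_zero_powerSeries (R := R)
  rw [map_pow, map_pow] at hq
  have hd : d⁄dX R (q * (X + C x * w) ^ 2) = d⁄dX R (w * (1 + C x ^ 2 * X + C y ^ 2 * w)) := congrArg (d⁄dX R) hq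
  rw [Derivation.leibniz, Derivation.leibniz_pow, map_add, Derivation.leibniz, derivative_X, derivative_C,
    Derivation.leibniz, map_add, map_add, Derivation.map_one_eq_zero, Derivation.leibniz, Derivation.leibniz, derivative_X,
    Derivation.leibniz_pow, derivative_C, hw'] at hd
  simp only [Derivation.leibniz_pow, derivative_C, smul_zero, smul_eq_mul, nsmul_eq_mul, Nat.cast_ofNat, mul_one,
    mul_zero, add_zero, zero_add] at hd
  have key : d⁄dX R q * (X + C x * w) * (X + C x * w) = 1 * (X + C x * w) * (X + C x * w) := by
    linear_combination hd + C x ^ 2 * hfix +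
      (C x ^ 2 * X ^ 3 + C y ^ 2 * X ^ 2 * w - C x * X * w - q * (X + C x * w) * (1 + C x * X ^ 2)) * h2
  have h1 := mul_robertDen_cancel (mul_robertDen_cancel key)
  exact h1

/-- **`φ·(d + q) = 1` and `q' = 1` ⟹ `φ' = φ²`** (characteristic `2`): the `𝔣₀ ≠ 1` Robert factor `φ_P = 1/(x(Q′ ⊕ T) − x_P)`
(`d = x′ − x_P`, the `φ` of `…JetInverse.coeff_inv_jet`) is a Riccati solution, `D log φ_P = φ_P`. [folklore] -/
theorem derivative_eq_sq_of_mul_eq_one {d : R} {q φ : R⟦X⟧} (hq : d⁄dX R q = 1) (hφ : φ * (C d + q) = 1) :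
    d⁄dX R φ = φ ^ 2 := by
  have h2 := two_eq_zero_powerSeries (R := R)
  have hd : d⁄dX R (φ * (C d + q)) = d⁄dX R 1 := congrArg (d⁄dX R) hφ
  rw [Derivation.leibniz, map_add, derivative_C, hq, Derivation.map_one_eq_zero] at hd
  simp only [smul_eq_mul, zero_add, mul_one] at hd
  linear_combination φ * hd - d⁄dX R φ * hφ - φ ^ 2 * h2

end TranslationQuotient

/-! ## §4 Riccati closure in characteristic `2` and the `D log` packaging -/

section Riccati

variable [CharP R 2]

/-- `f' = f²`, `g' = g²` ⟹ `(f + g)' = (f + g)²` (characteristic `2`: the cross term `2fg` vanishes). [folklore] -/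
theorem riccati_add {f g : R⟦X⟧} (hf : d⁄dX R f = f ^ 2) (hg : d⁄dX R g = g ^ 2) : d⁄dX R (f + g) = (f + g) ^ 2 := by
  have h2 := two_eq_zero_powerSeries (R := R)
  rw [map_add, hf, hg]
  linear_combination (-(f * g)) * h2

/-- A finite sum of Riccati solutions is a Riccati solution (characteristic `2`) — e.g. `Φ = Σ_P φ_P`. [folklore] -/
theorem riccati_sum {ι : Type*} (s : Finset ι) (f : ι → R⟦X⟧) (h : ∀ i ∈ s, d⁄dX R (f i) = f i ^ 2) :
    d⁄dX R (∑ i ∈ s, f i) = (∑ i ∈ s, f i) ^ 2 := by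
  classical
  induction s using Finset.induction_on with
  | empty => simp
  | insert a s ha ih =>
    rw [Finset.sum_insert ha]
    exact riccati_add (h a (Finset.mem_insert_self a s)) (ih fun i hi => h i (Finset.mem_insert_of_mem hi))

omit [CharP R 2] in
/-- `f' = f²` ⟹ `(c·f(ct))' = (c·f(ct))²` (any `c`, any characteristic; `(f(ct))' = c f'(ct)`). [folklore] -/
theorem riccati_C_mul_rescale (c : R) {f : R⟦X⟧} (hf : d⁄dX R f = f ^ 2) :
    d⁄dX R (C c * rescale c f) = (C c * rescale c f) ^ 2 := by
  rw [Derivation.leibniz, derivative_C, derivative_rescale', hf, map_pow]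
  simp only [smul_eq_mul, mul_zero, add_zero]
  ring

/-- **The `ρ`-symmetrisation of a Riccati solution is a Riccati solution**: `Φ' = Φ²` ⟹ `S₀' = S₀²` for
`S₀ = λΦ(λt) + λ²Φ(λ²t)` (any `λ`) — hypothesis `hR` of the level-one wall `…JetLevelOneWall.X_pow_fourteen_dvd_levelOne_sub`. [folklore] -/
theorem riccati_rhoSymm (l : R) {Φ : R⟦X⟧} (hΦ : d⁄dX R Φ = Φ ^ 2) :
    d⁄dX R (C l * rescale l Φ + C (l ^ 2) * rescale (l ^ 2) Φ) =
      (C l * rescale l Φ + C (l ^ 2) * rescale (l ^ 2) Φ) * (C l * rescale l Φ + C (l ^ 2) * rescale (l ^ 2) Φ) := by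
  rw [← sq]
  exact riccati_add (riccati_C_mul_rescale l hΦ) (riccati_C_mul_rescale (l ^ 2) hΦ)

omit [CharP R 2] in
/-- `f' = f²` packaged as `Z·S = Z'` with `Z = S = f` (`D log f = f`). [folklore] -/
theorem mul_self_eq_derivative_of_riccati {f : R⟦X⟧} (hf : d⁄dX R f = f ^ 2) : f * f = d⁄dX R f := by
  rw [hf, sq]

omit [CharP R 2] in
/-- **`Σ_P φ_P` is `D log ∏_P φ_P`**: if every `φᵢ' = φᵢ²` then `(∏ᵢ φᵢ)·(Σᵢ φᵢ) = (∏ᵢ φᵢ)'` (any characteristic) — the input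
`Z·S = Z'` of `logDeriv_rhoProduct_one` (then `Z^ρ·S^ρ = (Z^ρ)'` for `θ̄^ρ = θ̄(λt)θ̄(λ²t)`, `Φ_ρ = λΦ(λt) + λ²Φ(λ²t)`) and, level by
level, of the tilt engine `Tilt.oddDigit_of_nonDeg_tiltCurve` (`hZS`). [folklore] -/
theorem prod_mul_sum_eq_derivative_prod {ι : Type*} (s : Finset ι) (f : ι → R⟦X⟧) (h : ∀ i ∈ s, d⁄dX R (f i) = f i ^ 2) :
    (∏ i ∈ s, f i) * (∑ i ∈ s, f i) = d⁄dX R (∏ i ∈ s, f i) := by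
  classical
  induction s using Finset.induction_on with
  | empty => simp
  | insert a s ha ih =>
    rw [Finset.prod_insert ha, Finset.sum_insert ha]
    have h1 : f a * f a = 1 * d⁄dX R (f a) := by
      rw [one_mul]; exact mul_self_eq_derivative_of_riccati (h a (Finset.mem_insert_self a s))
    have h2 : (∏ i ∈ s, f i) * (∑ i ∈ s, f i) = 1 * d⁄dX R (∏ i ∈ s, f i) := by
      rw [one_mul]; exact ih fun i hi => h i (Finset.mem_insert_of_mem hi)
    have h := Tilt.logDeriv_mul h1 h2
    rwa [one_mul] at h

omit [CharP R 2] in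
/-- The `ρ`-projected Robert factor: for `θ' = θ²` (e.g. `θ_c`), `θ^ρ := θ(λt)·θ(λ²t)` and `S₀ := λθ(λt) + λ²θ(λ²t)` satisfy
`θ^ρ · S₀ = (θ^ρ)'` — `S₀ = D log θ̄^ρ` for the single-factor (`N𝔩 = 3`, `𝔣₀ = 1`) Robert function of the calibration class. [folklore] -/
theorem rhoProduct_mul_rhoSymm_eq_derivative (l : R) {θ : R⟦X⟧} (hθ : d⁄dX R θ = θ ^ 2) :
    (rescale l θ * rescale (l ^ 2) θ) * (C l * rescale l θ + C (l ^ 2) * rescale (l ^ 2) θ) =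
      d⁄dX R (rescale l θ * rescale (l ^ 2) θ) :=
  logDeriv_rhoProduct_one (mul_self_eq_derivative_of_riccati hθ)

end Riccati

end Summit.BirchSwinnertonDyer.BirchSwinnertonDyer.Theorems.SignedMuAtTwo.JetCharacterSums

end
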